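import Summits.KontsevichZagierPeriods.KontsevichZagierPeriods.Theorems.LinRedNormalFormArrangementNormalFormSeparateEngine

/-!
# Thin contacts with at most one special point are hereditarily unblocked
(stub `stub_separateThreeZero`, part `Unblocked`)

(Line `janus-bands`, crux `ArrangementNormalForm`, stub `stub_separateThreeZero` — fibre-free
separation over a bounded rational polytope in `ℝ³`, `JJ 3 0 → closure (GG 2 1 0)`; part
`Unblocked`: the combinatorial-geometric input `hunb` of the contact-aware engine
`SepThree.sepC_induction`.)

**Lemma** (`SepThree.exists_splittable`, abstract convex geometry in a real vector space `E`).
Let `K ⊆ K₀` with `K` convex, `H_i` (`i` in a finite index type) convex sets ("pole planes"),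
`S ⊆ act` index predicates, `D` a "distinct" relation with `z ∈ H_i ∖ H_j → D i j`. Assume
THIN: for `act i`, `H_i ∩ K₀` lies in a line `{P + t u}`; and SEP: `K` contains at most one
SPECIAL POINT `X` (`H_i ∩ H_{i'} ∩ K₀ = {X}` for some `D`-pair of `act` indices). If `S` contains
a `D`-pair, then some `D`-pair `(i, i')` in `S` is SPLITTABLE: `H_i ∩ H_{i'} ∩ K ⊆ H_j` for every
`j ∈ S`. Proof: a `D`-pair in `S` with minimal contact `G_i ∩ G_{i'}` (`G_i = H_i ∩ K`) is
splittable; otherwise there are `z ∈ G_i ∩ G_{i'} ∖ H_j`, `a ∈ G_i ∩ G_j ∖ H_{i'}`,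
`c ∈ G_{i'} ∩ G_j ∖ H_i` (minimality), which are not collinear by convexity of the three
contacts, so the three thin lines are pairwise distinct and `z ≠ a` are two special points of `K`.

`SepThree.hunb_of_thin` translates the lemma into the hypothesis `hunb` of `sepC_induction`
(pole planes `y = λ_j(x')`, `K` the closed base cell, `D j j' := λ_j ≠ λ_{j'}`).
-/

noncomputable section

open Set

namespace Summit.KontsevichZagierPeriods.ArrangementNormalForm.JanusBands

open Literature.NumberTheory.Transcendental

namespace SepThree

section Abstract

variable {E : Type*} [AddCommGroup E] [Module ℝ E]

/-- Three points `z ∈ G₁ ∩ G₂ ∖ G₃`, `a ∈ G₁ ∩ G₃ ∖ G₂`, `c ∈ G₂ ∩ G₃ ∖ G₁` of three convex sets are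
not collinear. -/
theorem not_collinear_of_convex {G₁ G₂ G₃ : Set E} (h₁ : Convex ℝ G₁) (h₂ : Convex ℝ G₂)
    (h₃ : Convex ℝ G₃) {z a c : E} (hz₁ : z ∈ G₁) (hz₂ : z ∈ G₂) (hz₃ : z ∉ G₃) (ha₁ : a ∈ G₁)
    (ha₃ : a ∈ G₃) (ha₂ : a ∉ G₂) (hc₂ : c ∈ G₂) (hc₃ : c ∈ G₃) (hc₁ : c ∉ G₁) (s : ℝ) :
    c ≠ z + s • (a - z) := by
  intro hc
  have hc' : c = (1 - s) • z + s • a := by rw [hc, sub_smul, one_smul, smul_sub]; abel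
  rcases lt_trichotomy s 0 with hs | rfl | hs
  · -- `z` lies between `c` and `a`
    have h1s : (0 : ℝ) < 1 - s := by linarith
    refine hz₃ ?_
    have key : z = ((1 - s)⁻¹) • c + ((1 - s)⁻¹ * (-s)) • a := by
      rw [mul_smul, ← smul_add, hc', add_assoc, ← add_smul, add_neg_cancel, zero_smul, add_zero,
        smul_smul, inv_mul_cancel₀ h1s.ne', one_smul]
    rw [key]
    exact h₃ hc₃ ha₃ (inv_nonneg.2 h1s.le) (mul_nonneg (inv_nonneg.2 h1s.le) (by linarith))
      (by rw [← mul_one_add, show 1 + -s = 1 - s by ring, inv_mul_cancel₀ h1s.ne'])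
  · refine hc₁ ?_
    rw [hc', sub_zero, one_smul, zero_smul, add_zero]
    exact hz₁
  · rcases lt_trichotomy s 1 with hs1 | rfl | hs1
    · -- `c` lies between `z` and `a`
      refine hc₁ ?_
      rw [hc']
      exact h₁ hz₁ ha₁ (by linarith) hs.le (by ring)
    · refine ha₂ ?_
      rw [hc', sub_self, zero_smul, zero_add, one_smul] at hc₂
      exact hc₂
    · -- `a` lies between `z` and `c`
      refine ha₂ ?_
      have key : a = (s⁻¹ * (s - 1)) • z + s⁻¹ • c := by
        rw [mul_smul, ← smul_add, hc', ← add_assoc, ← add_smul, sub_add_sub_cancel', sub_self,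
          zero_smul, zero_add, smul_smul, inv_mul_cancel₀ hs.ne', one_smul]
      rw [key]
      exact h₂ hz₂ hc₂ (mul_nonneg (inv_nonneg.2 hs.le) (by linarith)) (inv_nonneg.2 hs.le)
        (by rw [← mul_add_one, sub_add_cancel, inv_mul_cancel₀ hs.ne'])

/-- Two distinct points of a parametrised line reparametrise it. -/
theorem line_reparam {P u z a w : E} {t₁ t₂ t : ℝ} (hz : z = P + t₁ • u) (ha : a = P + t₂ • u)
    (hza : z ≠ a) (hw : w = P + t • u) : ∃ s : ℝ, w = z + s • (a - z) := by
  have ht : t₂ - t₁ ≠ 0 := fun h => hza (by rw [hz, ha, show t₂ = t₁ by linarith])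
  refine ⟨(t - t₁) / (t₂ - t₁), ?_⟩
  rw [ha, hz, hw, add_sub_add_left_eq_sub, ← sub_smul, smul_smul, div_mul_cancel₀ _ ht, add_assoc,
    ← add_smul, add_sub_cancel]

/-- **Splittable pairs exist** (abstract form): see the module docstring. -/
theorem exists_splittable {ι : Type*} [Finite ι] (S act : ι → Prop) (D : ι → ι → Prop)
    (H : ι → Set E) (K K₀ : Set E) (hK : Convex ℝ K) (hH : ∀ i, Convex ℝ (H i)) (hKK₀ : K ⊆ K₀)
    (hS : ∀ i, S i → act i) (hD : ∀ i j, ∀ z ∈ H i, z ∉ H j → D i j)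
    (hthin : ∀ i, act i → ∃ P u : E, ∀ Q ∈ H i ∩ K₀, ∃ t : ℝ, Q = P + t • u)
    (hsep : ∀ X X' : E, X ∈ K → X' ∈ K →
      (∃ i i', act i ∧ act i' ∧ D i i' ∧ H i ∩ H i' ∩ K₀ = {X}) →
      (∃ i i', act i ∧ act i' ∧ D i i' ∧ H i ∩ H i' ∩ K₀ = {X'}) → X = X')
    (hex : ∃ i i', S i ∧ S i' ∧ D i i') :
    ∃ i i', S i ∧ S i' ∧ D i i' ∧ ∀ z ∈ H i ∩ H i' ∩ K, ∀ j, S j → z ∈ H j := by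
  classical
  -- a `D`-pair of `S` with minimal contact
  set Pairs : Set (ι × ι) := {q | S q.1 ∧ S q.2 ∧ D q.1 q.2} with hPairs
  have hfin : Pairs.Finite := Set.toFinite _
  have hne : Pairs.Nonempty := by
    obtain ⟨i, i', hi, hi', hD'⟩ := hex
    exact ⟨(i, i'), hi, hi', hD'⟩
  obtain ⟨⟨i, i'⟩, ⟨hi, hi', hDii'⟩, hmin⟩ :=
    hfin.exists_minimalFor (fun q : ι × ι => H q.1 ∩ H q.2 ∩ K) Pairs hne
  refine ⟨i, i', hi, hi', hDii', fun z hz j hj => ?_⟩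
  by_contra hzj
  obtain ⟨⟨hzi, hzi'⟩, hzK⟩ := hz
  -- the pairs `(i, j)` and `(i', j)` are `D`-pairs whose contacts are not smaller
  have hmin' : ∀ i₁, S i₁ → z ∈ H i₁ → ∃ a ∈ H i₁ ∩ H j ∩ K, a ∉ H i ∩ H i' ∩ K := by
    intro i₁ hi₁ hzi₁
    have hq : (i₁, j) ∈ Pairs := ⟨hi₁, hj, hD i₁ j z hzi₁ hzj⟩
    by_contra hall
    push Not at hall
    have hsub : H i₁ ∩ H j ∩ K ⊆ H i ∩ H i' ∩ K := fun a ha => hall a ha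
    have heq := hmin hq hsub
    exact hzj (heq ⟨⟨hzi, hzi'⟩, hzK⟩).1.2
  obtain ⟨a, ⟨⟨hai, haj⟩, haK⟩, ha'⟩ := hmin' i hi hzi
  obtain ⟨c, ⟨⟨hci', hcj⟩, hcK⟩, hc'⟩ := hmin' i' hi' hzi'
  have hai' : a ∉ H i' := fun h => ha' ⟨⟨hai, h⟩, haK⟩
  have hci : c ∉ H i := fun h => hc' ⟨⟨h, hci'⟩, hcK⟩
  have hza : z ≠ a := fun h => hai' (h ▸ hzi')
  have hzc : z ≠ c := fun h => hci (h ▸ hzi)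
  have hac : a ≠ c := fun h => hai' (h ▸ hci')
  -- the three points are not collinear
  have hncol : ∀ s : ℝ, c ≠ z + s • (a - z) :=
    not_collinear_of_convex ((hH i).inter hK) ((hH i').inter hK) ((hH j).inter hK)
      ⟨hzi, hzK⟩ ⟨hzi', hzK⟩ (fun h => hzj h.1) ⟨hai, haK⟩ ⟨haj, haK⟩ (fun h => hai' h.1)
      ⟨hci', hcK⟩ ⟨hcj, hcK⟩ (fun h => hci h.1)
  -- the thin lines through the three contacts
  obtain ⟨Pi, ui, hli⟩ := hthin i (hS i hi)
  obtain ⟨Pi', ui', hli'⟩ := hthin i' (hS i' hi')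
  obtain ⟨Pj, uj, hlj⟩ := hthin j (hS j hj)
  obtain ⟨tz, htz⟩ := hli z ⟨hzi, hKK₀ hzK⟩
  obtain ⟨ta, hta⟩ := hli a ⟨hai, hKK₀ haK⟩
  obtain ⟨tz', htz'⟩ := hli' z ⟨hzi', hKK₀ hzK⟩
  obtain ⟨tc', htc'⟩ := hli' c ⟨hci', hKK₀ hcK⟩
  obtain ⟨sa, hsa⟩ := hlj a ⟨haj, hKK₀ haK⟩
  obtain ⟨sc, hsc⟩ := hlj c ⟨hcj, hKK₀ hcK⟩
  -- `z` and `a` are special points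
  have hzspec : H i ∩ H i' ∩ K₀ = {z} := by
    refine Set.eq_singleton_iff_unique_mem.2 ⟨⟨⟨hzi, hzi'⟩, hKK₀ hzK⟩, fun w hw => ?_⟩
    obtain ⟨tw, htw⟩ := hli w ⟨hw.1.1, hw.2⟩
    obtain ⟨tw', htw'⟩ := hli' w ⟨hw.1.2, hw.2⟩
    obtain ⟨s₁, hs₁⟩ := line_reparam htz hta hza htw
    obtain ⟨s₂, hs₂⟩ := line_reparam htz' htc' hzc htw'
    by_contra hwz
    have hs₂0 : s₂ ≠ 0 := fun h => hwz (by rw [hs₂, h, zero_smul, add_zero])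
    refine hncol (s₂⁻¹ * s₁) ?_
    have h3 : s₂ • (c - z) = s₁ • (a - z) := by
      have := hs₁.symm.trans hs₂
      exact (add_left_cancel this).symm
    rw [mul_smul, ← h3, smul_smul, inv_mul_cancel₀ hs₂0, one_smul, add_sub_cancel]
  have haspec : H i ∩ H j ∩ K₀ = {a} := by
    refine Set.eq_singleton_iff_unique_mem.2 ⟨⟨⟨hai, haj⟩, hKK₀ haK⟩, fun w hw => ?_⟩
    obtain ⟨tw, htw⟩ := hli w ⟨hw.1.1, hw.2⟩
    obtain ⟨sw, hsw⟩ := hlj w ⟨hw.1.2, hw.2⟩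
    obtain ⟨s₁, hs₁⟩ := line_reparam hta htz hza.symm htw
    obtain ⟨s₂, hs₂⟩ := line_reparam hsa hsc hac hsw
    by_contra hwa
    have hs₂0 : s₂ ≠ 0 := fun h => hwa (by rw [hs₂, h, zero_smul, add_zero])
    refine hncol (1 - s₂⁻¹ * s₁) ?_
    have h3 : s₂ • (c - a) = s₁ • (z - a) := by
      have := hs₁.symm.trans hs₂
      exact (add_left_cancel this).symm
    have h4 : c - a = (s₂⁻¹ * s₁) • (z - a) := by
      rw [mul_smul, ← h3, smul_smul, inv_mul_cancel₀ hs₂0, one_smul]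
    have h5 : (s₂⁻¹ * s₁) • (a - z) = a - c := by
      rw [← neg_sub z a, smul_neg, ← h4, neg_sub]
    rw [sub_smul, one_smul, h5]
    abel
  exact hza (hsep z a hzK haK ⟨i, i', hS i hi, hS i' hi', hDii', hzspec⟩
    ⟨i, j, hS i hi, hS j hj, hD i j z hzi hzj, haspec⟩)

end Abstract

section Engine

open SeparatePos

variable {b k : ℕ}

/-- A base affine form at a convex combination. -/
theorem affB_combo (c : (Fin b → ℚ) × ℚ) (x y : Fin (b + 1 + k) → ℝ) {α β : ℝ} (h : α + β = 1) :
    affB b k c (α • x + β • y) = α * affB b k c x + β * affB b k c y := by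
  simp only [affB, Pi.add_apply, Pi.smul_apply, smul_eq_mul]
  have hs : ∑ i, (c.1 i : ℝ) * (α * x (Fin.castAdd k (Fin.castSucc i)) +
      β * y (Fin.castAdd k (Fin.castSucc i))) =
      α * ∑ i, (c.1 i : ℝ) * x (Fin.castAdd k (Fin.castSucc i)) +
        β * ∑ i, (c.1 i : ℝ) * y (Fin.castAdd k (Fin.castSucc i)) := by
    rw [Finset.mul_sum, Finset.mul_sum, ← Finset.sum_add_distrib]
    exact Finset.sum_congr rfl fun i _ => by ring
  rw [hs]
  linear_combination (-(c.2 : ℝ)) * h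

/-- A full-base literal affine form at a convex combination. -/
theorem litF_combo (c : (Fin (b + 1) → ℚ) × ℚ) (x y : Fin (b + 1 + k) → ℝ) {α β : ℝ}
    (h : α + β = 1) :
    (∑ i, (c.1 i : ℝ) * (α • x + β • y) (Fin.castAdd k i) + (c.2 : ℝ)) =
      α * (∑ i, (c.1 i : ℝ) * x (Fin.castAdd k i) + (c.2 : ℝ)) +
        β * (∑ i, (c.1 i : ℝ) * y (Fin.castAdd k i) + (c.2 : ℝ)) := by
  simp only [Pi.add_apply, Pi.smul_apply, smul_eq_mul]
  have hs : ∑ i, (c.1 i : ℝ) * (α * x (Fin.castAdd k i) + β * y (Fin.castAdd k i)) =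
      α * ∑ i, (c.1 i : ℝ) * x (Fin.castAdd k i) + β * ∑ i, (c.1 i : ℝ) * y (Fin.castAdd k i) := by
    rw [Finset.mul_sum, Finset.mul_sum, ← Finset.sum_add_distrib]
    exact Finset.sum_congr rfl fun i _ => by ring
  rw [hs]
  linear_combination (-(c.2 : ℝ)) * h

/-- The pole plane `y = λ(x')` is convex. -/
theorem convex_plane (c : (Fin b → ℚ) × ℚ) :
    Convex ℝ {z : Fin (b + 1 + k) → ℝ | z (Fin.castAdd k (Fin.last b)) = affB b k c z} := by
  intro x hx y hy α β _ _ hαβ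
  show (α • x + β • y) (Fin.castAdd k (Fin.last b)) = affB b k c (α • x + β • y)
  rw [affB_combo c x y hαβ, Pi.add_apply, Pi.smul_apply, Pi.smul_apply, smul_eq_mul, smul_eq_mul,
    hx.out, hy.out]

/-- A mutual or affine fibre bound at a convex combination. -/
theorem elim_combo (lo : Fin k ⊕ ((Fin (b + 1) → ℚ) × ℚ)) (x y : Fin (b + 1 + k) → ℝ) {α β : ℝ}
    (h : α + β = 1) :
    Sum.elim (fun j => (α • x + β • y) (Fin.natAdd (b + 1) j))
        (fun c => ∑ i', (c.1 i' : ℝ) * (α • x + β • y) (Fin.castAdd k i') + (c.2 : ℝ)) lo =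
      α * Sum.elim (fun j => x (Fin.natAdd (b + 1) j))
          (fun c => ∑ i', (c.1 i' : ℝ) * x (Fin.castAdd k i') + (c.2 : ℝ)) lo +
        β * Sum.elim (fun j => y (Fin.natAdd (b + 1) j))
          (fun c => ∑ i', (c.1 i' : ℝ) * y (Fin.castAdd k i') + (c.2 : ℝ)) lo := by
  cases lo with
  | inl j => simp
  | inr c => simp only [Sum.elim_inr]; exact litF_combo c x y h

/-- The base cell `gDom` (polyhedral base × Janus fibres) is convex. -/
theorem convex_gDom (m' : ℕ) (M : Fin m' → (Fin (b + 1) → ℚ) × ℚ)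
    (lo hi : Fin k → Fin k ⊕ ((Fin (b + 1) → ℚ) × ℚ)) : Convex ℝ (gDom b k m' M lo hi) := by
  intro x hx y hy α β hα hβ hαβ
  obtain ⟨hx1, hx2⟩ := hx
  obtain ⟨hy1, hy2⟩ := hy
  -- one of the weights is positive
  have hpos : ∀ {p q : ℝ}, 0 < p → 0 < q → 0 < α * p + β * q := fun {p q} hp hq => by
    rcases hα.lt_or_eq with hα' | hα'
    · exact add_pos_of_pos_of_nonneg (mul_pos hα' hp) (mul_nonneg hβ hq.le)
    · rw [← hα', zero_mul, zero_add, show β = 1 by linarith, one_mul]; exact hq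
  refine ⟨fun j => ?_, fun i => ⟨?_, ?_⟩⟩
  · rw [litF_combo (M j) x y hαβ]; exact hpos (hx1 j) (hy1 j)
  · rw [elim_combo (lo i) x y hαβ]
    have h1 := (hx2 i).1
    have h2 := (hy2 i).1
    have := hpos (sub_pos.2 h1) (sub_pos.2 h2)
    simp only [Pi.add_apply, Pi.smul_apply, smul_eq_mul]
    linarith
  · rw [elim_combo (hi i) x y hαβ]
    have h1 := (hx2 i).2
    have h2 := (hy2 i).2
    have := hpos (sub_pos.2 h1) (sub_pos.2 h2)
    simp only [Pi.add_apply, Pi.smul_apply, smul_eq_mul]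
    linarith

/-- **Thin contacts with at most one special point are hereditarily unblocked**: the
hypothesis `hunb` of `SepThree.sepC_induction` for a base cell whose closure lies in a set `K₀`
on which every active pole plane `y = λ_j(x')` has THIN contact (contained in a line) and which
contains at most one SPECIAL POINT (a singleton contact `{y = λ_j} ∩ {y = λ_{j'}} ∩ K₀` of two
distinct active poles). -/
theorem hunb_of_thin {m' r : ℕ} (M : Fin m' → (Fin (b + 1) → ℚ) × ℚ)
    (lo hi : Fin k → Fin k ⊕ ((Fin (b + 1) → ℚ) × ℚ)) (lam : Fin r → (Fin b → ℚ) × ℚ)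
    (act : Fin r → Prop) (K₀ : Set (Fin (b + 1 + k) → ℝ))
    (hK₀ : closure (gDom b k m' M lo hi) ⊆ K₀)
    (hthin : ∀ j, act j → ∃ P u : Fin (b + 1 + k) → ℝ, ∀ z ∈ K₀,
      z (Fin.castAdd k (Fin.last b)) = affB b k (lam j) z → ∃ t : ℝ, z = P + t • u)
    (hsep : ∀ X X' : Fin (b + 1 + k) → ℝ, X ∈ closure (gDom b k m' M lo hi) →
      X' ∈ closure (gDom b k m' M lo hi) →
      (∃ j j', act j ∧ act j' ∧ lam j ≠ lam j' ∧
        {z | z (Fin.castAdd k (Fin.last b)) = affB b k (lam j) z} ∩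
          {z | z (Fin.castAdd k (Fin.last b)) = affB b k (lam j') z} ∩ K₀ = {X}) →
      (∃ j j', act j ∧ act j' ∧ lam j ≠ lam j' ∧
        {z | z (Fin.castAdd k (Fin.last b)) = affB b k (lam j) z} ∩
          {z | z (Fin.castAdd k (Fin.last b)) = affB b k (lam j') z} ∩ K₀ = {X'}) → X = X') :
    ∀ S : Fin r → Prop, (∀ j, S j → act j) → (∃ j j', S j ∧ S j' ∧ lam j ≠ lam j') →
      ∃ j j', S j ∧ S j' ∧ lam j ≠ lam j' ∧ ∀ z ∈ closure (gDom b k m' M lo hi),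
        z (Fin.castAdd k (Fin.last b)) = affB b k (lam j) z →
        z (Fin.castAdd k (Fin.last b)) = affB b k (lam j') z →
        ∀ i, S i → z (Fin.castAdd k (Fin.last b)) = affB b k (lam i) z := by
  intro S hS hex
  set H : Fin r → Set (Fin (b + 1 + k) → ℝ) := fun j =>
    {z | z (Fin.castAdd k (Fin.last b)) = affB b k (lam j) z} with hHdef
  have hD : ∀ i j, ∀ z ∈ H i, z ∉ H j → lam i ≠ lam j := fun i j z hz hz' h => hz' (by
    show z (Fin.castAdd k (Fin.last b)) = affB b k (lam j) z
    rw [← h]; exact hz)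
  obtain ⟨j, j', hj, hj', hne, hgood⟩ := exists_splittable S act (fun i j => lam i ≠ lam j) H
    (closure (gDom b k m' M lo hi)) K₀ (convex_gDom m' M lo hi).closure
    (fun i => convex_plane (lam i)) hK₀ hS hD
    (fun i hi => by
      obtain ⟨P, u, h⟩ := hthin i hi
      exact ⟨P, u, fun Q hQ => h Q hQ.2 hQ.1⟩)
    hsep hex
  exact ⟨j, j', hj, hj', hne, fun z hz h1 h2 i hi => hgood z ⟨⟨h1, h2⟩, hz⟩ i hi⟩

end Engine

end SepThree

open SepThree SeparatePos in
/-- **Thin contacts with at most one special point are hereditarily unblocked** (registered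
sub-goal of `stub_separateThreeZero`, part `Unblocked`; literal form of `SepThree.hunb_of_thin`):
the hypothesis `hunb` of the contact-aware engine `SepThree.sepC_induction`. -/
theorem separateThree_unblocked (b k m' r : ℕ) (M : Fin m' → (Fin (b + 1) → ℚ) × ℚ) (lo hi : Fin k → Fin k ⊕ ((Fin (b + 1) → ℚ) × ℚ)) (lam : Fin r → (Fin b → ℚ) × ℚ) (act : Fin r → Prop) (K₀ : Set (Fin (b + 1 + k) → ℝ)) (hK₀ : closure (SeparatePos.gDom b k m' M lo hi) ⊆ K₀) (hthin : ∀ j, act j → ∃ P u : Fin (b + 1 + k) → ℝ, ∀ z ∈ K₀, z (Fin.castAdd k (Fin.last b)) = SeparatePos.affB b k (lam j) z → ∃ t : ℝ, z = P + t • u) (hsep : ∀ X X' : Fin (b + 1 + k) → ℝ, X ∈ closure (SeparatePos.gDom b k m' M lo hi) → X' ∈ closure (SeparatePos.gDom b k m' M lo hi) → (∃ j j', act j ∧ act j' ∧ lam j ≠ lam j' ∧ {z | z (Fin.castAdd k (Fin.last b)) = SeparatePos.affB b k (lam j) z} ∩ {z | z (Fin.castAdd k (Fin.last b)) = SeparatePos.affB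 b k (lam j') z} ∩ K₀ = {X}) → (∃ j j', act j ∧ act j' ∧ lam j ≠ lam j' ∧ {z | z (Fin.castAdd k (Fin.last b)) = SeparatePos.affB b k (lam j) z} ∩ {z | z (Fin.castAdd k (Fin.last b)) = SeparatePos.affB b k (lam j') z} ∩ K₀ = {X'}) → X = X') (S : Fin r → Prop) (hS : ∀ j, S j → act j) (hex : ∃ j j', S j ∧ S j' ∧ lam j ≠ lam j') : ∃ j j', S j ∧ S j' ∧ lam j ≠ lam j' ∧ ∀ z ∈ closure (SeparatePos.gDom b k m' M lo hi), z (Fin.castAdd k (Fin.last b)) = SeparatePos.affB b k (lam j) z → z (Fin.castAdd k (Fin.last b)) = SeparatePos.affB b k (lam j') z → ∀ i, S i → z (Fin.castAdd k (Fin.last b)) = SeparatePos.affB b k (lam i) z :=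
  hunb_of_thin M lo hi lam act K₀ hK₀ hthin hsep S hS hex

end Summit.KontsevichZagierPeriods.ArrangementNormalForm.JanusBands
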